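/-
Copyright: the b2b-balaban T⁴-continuum CRUX team, row NE7b OWNER lineage `t4-ne7b-p1` (gen 118). Project licence.
-/
import Summits.QuantumFields.BalabanUV.T4Continuum.Spine.NE7b.SupTorusEffectiveActionHessianFloor
import Summits.QuantumFields.BalabanUV.T4Continuum.Spine.NE7b.SupConvexStepHessian

/-!
# THE CONVEX TOWER ON THE TORUS, TWO STEPS IN CLOSED FORM: the sitewise torus action with `u′ ≥ −λ`, `λ < min(2,a)` is in the
# second-order class of (111) with `m = min(2,a) − λ`; its block-spin step produces the effective action `W₁` in the class
# `(Site d s, (min(2,a) − λ)(n+1)^d)`, and ANY second block map `Q₂` on the coarse torus (right inverse, block Jensen constant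
# `vol₂`) produces `W₂ = W₁ ∘ Φ₂ = S ∘ Φ₁ ∘ Φ₂`: `C¹` with a second derivative at every block field, first-order modulus and Hessian
# floor `(min(2,a) − λ)·(n+1)^d·vol₂`, and `Φ₁ ∘ Φ₂` minimises the ORIGINAL action on the composite fibres `{Q₂(Q′t ψ) = w₂}` —
# the k-step structure of the convex road without a small-field condition
# (row NE7b, node U5c; (110) + (111) + (93) + TEA BY NAME; [folklore])

Cell `pub-balaban`, sub-cell `t4`, spine estimate NE7b (`T4WeightBudget.RelWeightBound`; the cell's OWN estimate — NOT PRINTED in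
[Bałaban 1983–89], NOT PROVED).  Crux-route work under `Spine/NE7b/` by the row OWNER (`t4-ne7b-p1` gen 118) under FREEZE (0)'s
crux-prover clause; NOTHING of Bałaban's is named as a Lean object, valued or asserted; no `T4Continuum/Support` leaf typed; no `def`,
no notation (the second block map is ANY continuous linear `Q₂` with the two letters); zero `sorry`.  Imports (BY NAME): the OWNER's
(111) `…SupConvexStepHessian` (`step_closure₂`; through it (110) `torus_action_mem_class` ∕ `comp_critical` ∕ `isMinOn_of_critical`),
(90) `…SupTorusEffectiveActionHessianFloor` (`response_form_floor`), TEA `exists_clm_pairForm` ∕ `hasFDerivAt_fderiv_action`, (93)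
`sitewise_of_critical`, (96) `exists_clm_blockLift`, (89) `torus_form_coercive` ∕ `blockVolume_mul_sum_sq_blockAvg_le`, TDF
`torus_operator_form_symm`.

WHY (located).  The sup road's tower ((76) semigroup, (80) tower) lives in a small `ℓ^∞` ball with two-sided letters; the convex road
has no ball, and after (110)∕(111) its step is an operation on a CLASS, so the tower is just iteration.  This file spells out the first
two floors of the tower on the actual torus carriers: the first block map is the torus block mean `Q′t = Rc∘Dop∘Ef` (block lift,
Jensen constant `(n+1)^d`), the second is left abstract (any `Q₂` — e.g. the block mean of the next scale), and everything is read back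
on the original fine action: the composite background minimises `S` on the composite fibres.

WHAT IS PROVED ([folklore]):
* §1 **`torus_action_mem_class₂`** (`∃ S″` — TEA's linearised form — with `HasFDerivAt S (DS φ) φ`, `HasFDerivAt DS (S″ φ) φ`, the
  first-order letter and the floor, modulus `min(2,a) − λ`).
* §2 THE END **`torus_twoStep_tower`** (for ANY `Q₂, M₂, vol₂`: `∃ Φ₁ Φ₂ W₂′ W₂″` with `Q′t(Φ₁ w) = w` and the sitewise equation at
  every `w`, `Q₂(Φ₂ w₂) = w₂`, `Φ₁(Φ₂ w₂)` minimising `S` on `{ψ | Q₂(Q′t ψ) = w₂}`, `HasFDerivAt (S ∘ Φ₁ ∘ Φ₂) (W₂′ w₂) w₂`,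
  `HasFDerivAt W₂′ (W₂″ w₂) w₂`, the first-order letter of `S ∘ Φ₁ ∘ Φ₂` with modulus `(min(2,a) − λ)(n+1)^d·vol₂`, and the floor
  `(min(2,a) − λ)(n+1)^d·vol₂·Σ k² ≤ W₂″ w₂ k k`).
* §3 toy.

HONEST (what this is NOT).  Two explicit floors of an abstract iteration; the second block map is not instantiated as the next torus
block mean (that is bookkeeping on `Site d s` with `s = (n₂+1)s₂`, not done); no locality, no measure, no small-field analysis; constants
OURS; cubic periods; scalar skeleton, hard constraint ((A3), NC-NE7b-α UNRULED); nothing of Bałaban's.  BY-NAME EFFECT ON THE WALL: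
NONE.  NE7b NOT PRINTED ∕ NOT PROVED; spine PROVED 0∕9; rung (B)+1 on a FINITE torus — NOT infinite volume, NOT the mass gap, NOT Clay.
HONEST DEPENDENCY: continuum YM on T⁴ ⇐ BetaPertH ∧ nine spine estimates (0∕9 proved); BetaPertH ⇐ (D1) ∧ (D4) ∧ CAP+tail; G-an2-4
gates asym, D1 and NE2∕3∕4.
-/

set_option autoImplicit false

noncomputable section

namespace Summit.QuantumFields.BalabanUV.T4Continuum.NE7b.SupConvexStepTorusTower

open Set Function
open scoped ENNReal
open Literature.MathematicalPhysics.QuantumFieldTheory.Balaban1983to89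
open B6QGQLower276 (X blk B side AX)
open B5Hk103ScalarZd (nbhd)
open Beta (Site siteOf windowMap)
open SupTorusDirichletForm (torus_operator_form_symm)
open SupTorusDirichletFormCoercive (torus_form_coercive blockVolume_mul_sum_sq_blockAvg_le)
open SupTorusEffectiveAction (exists_clm_pairForm hasFDerivAt_fderiv_action)
open SupTorusEffectiveActionHessianFloor (response_form_floor)
open SupTorusActionMinimiser (sitewise_of_critical)
open SupTorusEffectiveActionGradient (exists_clm_blockLift)
open SupConvexStepSemigroup (torus_action_mem_class comp_critical isMinOn_of_critical)
open SupConvexStepHessian (step_closure₂)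

variable {d : ℕ}

section Torus

variable (n : ℕ) (a : ℝ) (s : ℕ) [NeZero s]
  {Dop Aop : lp (fun _ : X d => ℝ) ∞ →L[ℝ] lp (fun _ : X d => ℝ) ∞}
  (hD : ∀ (f : lp (fun _ : X d => ℝ) ∞) (y : X d), Dop f y = (((n : ℝ) + 1) ^ d)⁻¹ * ∑ p ∈ B n y, f p)
  (hA : ∀ (f : lp (fun _ : X d => ℝ) ∞) (p : X d), Aop f p = ∑ r ∈ nbhd n p, AX n a p r * f r)
  {v u u' : ℝ → ℝ} (hv : ∀ t, HasDerivAt v (u t) t) (hu : ∀ t, HasDerivAt u (u' t) t)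
  {lam : ℝ} (hu' : ∀ t, -lam ≤ u' t) (hγ : lam < min 2 a)
  {Ef : (Site d ((n + 1) * s) → ℝ) →L[ℝ] lp (fun _ : X d => ℝ) ∞}
  (hEf : ∀ (g : Site d ((n + 1) * s) → ℝ) (q : X d), Ef g q = g (siteOf d ((n + 1) * s) q))
  {Rf : lp (fun _ : X d => ℝ) ∞ →L[ℝ] (Site d ((n + 1) * s) → ℝ)}
  (hRf : ∀ (h : lp (fun _ : X d => ℝ) ∞) (x : Site d ((n + 1) * s)), Rf h x = h (windowMap d ((n + 1) * s) x))
  {Rc : lp (fun _ : X d => ℝ) ∞ →L[ℝ] (Site d s → ℝ)}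
  (hRc : ∀ (h : lp (fun _ : X d => ℝ) ∞) (x : Site d s), Rc h x = h (windowMap d s x))

/-! ## §1. The torus action is in the second-order class -/

include hA hv hu hu' hEf hRf in
/-- **THE TORUS ACTION IS IN THE SECOND-ORDER CLASS WITH `m = min(2,a) − λ`**: `At = Rf∘Aop∘Ef`, `v′ = u`, `u′` a derivative of
`u` with `u′ ≥ −λ` on `ℝ`.  With `S′ := fderiv S` there is `S″` (TEA's linearised form `Σ ((At k) x + u′(φ x)·k x)·k′ x`) such that
`HasFDerivAt S (S′ φ) φ`, `HasFDerivAt S′ (S″ φ) φ`, the first-order letter and the floor hold with `min(2,a) − λ` — so §2–§3 apply to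
the torus action and, by closure, to every effective action it generates along any tower of block maps. [folklore] -/
theorem torus_action_mem_class₂ :
    ∃ S'' : (Site d ((n + 1) * s) → ℝ) →
        (Site d ((n + 1) * s) → ℝ) →L[ℝ] (Site d ((n + 1) * s) → ℝ) →L[ℝ] ℝ,
      (∀ φ : Site d ((n + 1) * s) → ℝ,
        HasFDerivAt (fun φ : Site d ((n + 1) * s) → ℝ =>
            (1 / 2 : ℝ) * ∑ x, φ x * ((Rf.comp Aop).comp Ef) φ x + ∑ x, v (φ x))
          (fderiv ℝ (fun φ : Site d ((n + 1) * s) → ℝ =>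
            (1 / 2 : ℝ) * ∑ x, φ x * ((Rf.comp Aop).comp Ef) φ x + ∑ x, v (φ x)) φ) φ) ∧
      (∀ φ ψ : Site d ((n + 1) * s) → ℝ,
        ((1 / 2 : ℝ) * ∑ x, φ x * ((Rf.comp Aop).comp Ef) φ x + ∑ x, v (φ x))
          + fderiv ℝ (fun φ : Site d ((n + 1) * s) → ℝ =>
              (1 / 2 : ℝ) * ∑ x, φ x * ((Rf.comp Aop).comp Ef) φ x + ∑ x, v (φ x)) φ (ψ - φ)
          + (min 2 a - lam) / 2 * ∑ x, (ψ x - φ x) ^ 2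
        ≤ (1 / 2 : ℝ) * ∑ x, ψ x * ((Rf.comp Aop).comp Ef) ψ x + ∑ x, v (ψ x)) ∧
      (∀ φ : Site d ((n + 1) * s) → ℝ,
        HasFDerivAt (fderiv ℝ (fun φ : Site d ((n + 1) * s) → ℝ =>
          (1 / 2 : ℝ) * ∑ x, φ x * ((Rf.comp Aop).comp Ef) φ x + ∑ x, v (φ x))) (S'' φ) φ) ∧
      (∀ φ h : Site d ((n + 1) * s) → ℝ, (min 2 a - lam) * ∑ x, h x ^ 2 ≤ S'' φ h h) ∧
      ∀ φ k k' : Site d ((n + 1) * s) → ℝ,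
        S'' φ k k' = ∑ x, (((Rf.comp Aop).comp Ef) k x + u' (φ x) * k x) * k' x := by
  have hsymm := torus_operator_form_symm n a s hA hEf hRf
  have hfloor := torus_form_coercive n a s hA hEf hRf
  obtain ⟨h1, h2⟩ := torus_action_mem_class n a s hA hv hu hu' hEf hRf
  choose H hH using fun φ : Site d ((n + 1) * s) → ℝ => exists_clm_pairForm ((Rf.comp Aop).comp Ef) (fun x => u' (φ x))
  refine ⟨H, h1, h2, fun φ => hasFDerivAt_fderiv_action ((Rf.comp Aop).comp Ef) hsymm hv hu φ (hH φ), fun φ h => ?_, hH⟩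
  rw [hH]
  exact response_form_floor ((Rf.comp Aop).comp Ef) hfloor (fun x => hu' (φ x)) h


/-! ## §2. THE END: two floors of the tower -/

include hD hA hv hu hu' hγ hEf hRf hRc in
/-- **THE END: TWO STEPS OF THE CONVEX TOWER ON THE TORUS.**  `v′ = u`, `u′` a derivative of `u` with `u′ ≥ −λ` on `ℝ`,
`λ < min(2,a)`; first block map the torus block mean `Q′t = Rc∘Dop∘Ef`; second block map ANY continuous linear `Q₂` on the coarse
torus with a right inverse `M₂` and block Jensen constant `vol₂` (`vol₂·Σ_z (Q₂ k z)² ≤ Σ_y k y²`).  Then there are the torus background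
map `Φ₁` (block means + sitewise equation), a second-step map `Φ₂` (`Q₂(Φ₂ w₂) = w₂`) and derivative families `W₂′, W₂″` of the
twice-renormalised action `W₂ = S ∘ Φ₁ ∘ Φ₂` such that: `Φ₁(Φ₂ w₂)` MINIMISES THE ORIGINAL ACTION on the composite fibre
`{ψ | Q₂(Q′t ψ) = w₂}`; `HasFDerivAt W₂ (W₂′ w₂) w₂` and `HasFDerivAt W₂′ (W₂″ w₂) w₂` at every `w₂`; the first-order letter
`W₂ w₂ + W₂′ w₂ (w₂′ − w₂) + ½(min(2,a) − λ)(n+1)^d·vol₂·Σ(w₂′ − w₂)² ≤ W₂ w₂′`; and the floor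
`(min(2,a) − λ)(n+1)^d·vol₂·Σ_z k z² ≤ W₂″ w₂ k k` — every mesh, period, dimension. [folklore] -/
theorem torus_twoStep_tower {κ₂ : Type*} [Fintype κ₂] (Q₂ : (Site d s → ℝ) →L[ℝ] (κ₂ → ℝ)) (M₂ : (κ₂ → ℝ) →L[ℝ] (Site d s → ℝ))
    (hM₂ : ∀ k : κ₂ → ℝ, Q₂ (M₂ k) = k) {vol₂ : ℝ} (hJ₂ : ∀ k : Site d s → ℝ, vol₂ * ∑ z, Q₂ k z ^ 2 ≤ ∑ y, k y ^ 2) :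
    ∃ (Φ₁ : (Site d s → ℝ) → (Site d ((n + 1) * s) → ℝ)) (Φ₂ : (κ₂ → ℝ) → (Site d s → ℝ))
      (W₂' : (κ₂ → ℝ) → (κ₂ → ℝ) →L[ℝ] ℝ) (W₂'' : (κ₂ → ℝ) → (κ₂ → ℝ) →L[ℝ] (κ₂ → ℝ) →L[ℝ] ℝ),
      (∀ w, ((Rc.comp Dop).comp Ef) (Φ₁ w) = w) ∧
      (∀ (w : Site d s → ℝ) (p : X d), Aop (Ef (Φ₁ w)) p + u (Ef (Φ₁ w) p)
        = (((n : ℝ) + 1) ^ d)⁻¹ * ∑ p' ∈ B n (blk n p), (Aop (Ef (Φ₁ w)) p' + u (Ef (Φ₁ w) p'))) ∧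
      (∀ w₂, Q₂ (Φ₂ w₂) = w₂) ∧
      (∀ w₂, IsMinOn (fun φ : Site d ((n + 1) * s) → ℝ =>
          (1 / 2 : ℝ) * ∑ x, φ x * ((Rf.comp Aop).comp Ef) φ x + ∑ x, v (φ x))
        {ψ | (Q₂.comp ((Rc.comp Dop).comp Ef)) ψ = w₂} (Φ₁ (Φ₂ w₂))) ∧
      (∀ w₂, HasFDerivAt (fun w₂' : κ₂ → ℝ =>
          (1 / 2 : ℝ) * ∑ x, Φ₁ (Φ₂ w₂') x * ((Rf.comp Aop).comp Ef) (Φ₁ (Φ₂ w₂')) x + ∑ x, v (Φ₁ (Φ₂ w₂') x))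
        (W₂' w₂) w₂) ∧
      (∀ w₂, HasFDerivAt W₂' (W₂'' w₂) w₂) ∧
      (∀ w₂ w₂' : κ₂ → ℝ,
        ((1 / 2 : ℝ) * ∑ x, Φ₁ (Φ₂ w₂) x * ((Rf.comp Aop).comp Ef) (Φ₁ (Φ₂ w₂)) x + ∑ x, v (Φ₁ (Φ₂ w₂) x))
          + W₂' w₂ (w₂' - w₂) + (min 2 a - lam) * ((n : ℝ) + 1) ^ d * vol₂ / 2 * ∑ z, (w₂' z - w₂ z) ^ 2
        ≤ (1 / 2 : ℝ) * ∑ x, Φ₁ (Φ₂ w₂') x * ((Rf.comp Aop).comp Ef) (Φ₁ (Φ₂ w₂')) x + ∑ x, v (Φ₁ (Φ₂ w₂') x)) ∧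
      ∀ (w₂ k : κ₂ → ℝ), (min 2 a - lam) * ((n : ℝ) + 1) ^ d * vol₂ * ∑ z, k z ^ 2 ≤ W₂'' w₂ k k := by
  obtain ⟨M₁, -, hM₁⟩ := exists_clm_blockLift n s hD hEf hRc
  obtain ⟨S'', hS, hfo, hS2, hfl, -⟩ := torus_action_mem_class₂ n a s hA hv hu hu' hEf hRf
  have hm : 0 < min 2 a - lam := sub_pos.2 hγ
  have hJ₁ : ∀ h : Site d ((n + 1) * s) → ℝ,
      ((n : ℝ) + 1) ^ d * ∑ y, ((Rc.comp Dop).comp Ef) h y ^ 2 ≤ ∑ x, h x ^ 2 := fun h => by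
    simpa only [ContinuousLinearMap.comp_apply] using blockVolume_mul_sum_sq_blockAvg_le n s hD hEf hRc h
  -- step one: the torus block mean
  obtain ⟨Φ₁, D₁, hΦ₁Q, hΦ₁crit, -, hD₁Q, -, -, hW₁, hW₁2, hW₁fo, hW₁fl⟩ :=
    step_closure₂ hS hfo hm hS2 hfl ((Rc.comp Dop).comp Ef) M₁ hM₁ hJ₁
  -- step two: ANY second block map, applied to the class member `(W₁, W₁′, W₁″)`
  have hm₁ : 0 < (min 2 a - lam) * ((n : ℝ) + 1) ^ d := by positivity
  obtain ⟨Φ₂, D₂, hΦ₂Q, hΦ₂crit, -, -, -, -, hW₂, hW₂2, hW₂fo, hW₂fl⟩ :=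
    step_closure₂ (S := fun w : Site d s → ℝ =>
        (1 / 2 : ℝ) * ∑ x, Φ₁ w x * ((Rf.comp Aop).comp Ef) (Φ₁ w) x + ∑ x, v (Φ₁ w x))
      (S' := fun w => (fderiv ℝ (fun φ : Site d ((n + 1) * s) → ℝ =>
        (1 / 2 : ℝ) * ∑ x, φ x * ((Rf.comp Aop).comp Ef) φ x + ∑ x, v (φ x)) (Φ₁ w)).comp M₁)
      (S'' := fun w => (S'' (Φ₁ w)).bilinearComp (D₁ w) (D₁ w)) (m := (min 2 a - lam) * ((n : ℝ) + 1) ^ d)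
      hW₁ hW₁fo hm₁ hW₁2 hW₁fl Q₂ M₂ hM₂ hJ₂
  refine ⟨Φ₁, Φ₂, _, _, hΦ₁Q, fun w p => sitewise_of_critical n a s hD hA hEf hRf hRc hv (Φ₁ w) (hΦ₁crit w) p, hΦ₂Q,
    fun w₂ => ?_, hW₂, hW₂2, fun w₂ w₂' => ?_, fun w₂ k => ?_⟩
  · -- the semigroup: `Φ₁ ∘ Φ₂` is fibre-critical for the composite block map, hence minimises
    have hcc := comp_critical (S' := fun φ => fderiv ℝ (fun φ : Site d ((n + 1) * s) → ℝ =>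
        (1 / 2 : ℝ) * ∑ x, φ x * ((Rf.comp Aop).comp Ef) φ x + ∑ x, v (φ x)) φ)
      ((Rc.comp Dop).comp Ef) M₁ hM₁ Q₂ hΦ₁crit hΦ₂crit w₂
    have hmin := isMinOn_of_critical hfo hm.le (Q₂.comp ((Rc.comp Dop).comp Ef)) hcc
    have hcQ : (Q₂.comp ((Rc.comp Dop).comp Ef)) (Φ₁ (Φ₂ w₂)) = w₂ := by
      rw [ContinuousLinearMap.comp_apply, hΦ₁Q, hΦ₂Q]
    rwa [hcQ] at hmin
  · have h := hW₂fo w₂ w₂'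
    simpa only [mul_assoc, mul_div_assoc] using h
  · have h := hW₂fl w₂ k
    simpa only [mul_assoc] using h

end Torus

/-! ## §3. Toy -/

/-- Toy (the block Jensen letter of the identity block map with constant `1`, the shape `torus_twoStep_tower` asks of `Q₂`). -/
example (k : Unit → ℝ) : (1 : ℝ) * ∑ z, (ContinuousLinearMap.id ℝ (Unit → ℝ)) k z ^ 2 ≤ ∑ y, k y ^ 2 := by simp

end Summit.QuantumFields.BalabanUV.T4Continuum.NE7b.SupConvexStepTorusTower

end
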